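import Literature.NumberTheory.EllipticCurves.IwasawaTowerTorsionOrdinaryProofs
import Literature.NumberTheory.GaloisRepresentations.AbsIntegersEquiv
import HarnessLib

/-!
# The cyclotomic character of a number field is ramified above `ℓ`: some `τ ∈ I_𝔓`, `𝔓 ∣ v ∣ ℓ`,
# has `χ_ℓ(τ) ≠ 1` (Serre 1968, I.1.2; Neukirch II (7.13), I (9.4))

`Proofs` file (theorems only, no definitions, no named facts), topic `NumberTheory/EllipticCurves`
(placed here because its `ℚ`-input lives in `IwasawaTowerTorsionOrdinaryProofs`).

For a number field `K`, a prime `ℓ`, a finite place `v` of `K` above `ℓ` and a prime `𝔓` of the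
absolute integers `\bar ℤ_K` above `v`, **some element `τ` of the inertia group `I_𝔓 ≤ Γ_K` has
`χ_ℓ(τ) ≠ 1`** for the `ℓ`-adic cyclotomic character `χ_ℓ : Γ_K → ℤ_ℓˣ`
(`GaloisRep.cyclotomicCharacter`), i.e. `K(μ_{ℓ^∞})/K` is ramified above `v`
(`exists_mem_inertia_cyclotomicCharacter_ne_one`).  Serre, *Abelian ℓ-adic representations*
(1968), I.1.2 (the cyclotomic character is unramified exactly away from `ℓ`); Neukirch, *ANT*,
II (7.13) (`ℚ_ℓ(ζ_{ℓⁿ})/ℚ_ℓ` is totally ramified) with I (9.4) (behaviour of inertia groups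
under restriction).

Proof by restriction to `ℚ`, from three tree theorems: over `ℚ`, `χ_ℓ(I_{𝔓'}) = ℤ_ℓˣ` for
`𝔓' = 𝔓 ∩ \bar ℤ` (`exists_mem_inertia_cyclotomicCharacter_eq`, `IwasawaTowerTorsionOrdinaryProofs`);
`res⁻¹(I_{𝔓'}) = I_𝔓` for the restriction `res : Γ_K → Γ_ℚ`
(`comap_inertia_comap_absIntegersMap`, `AbsIntegersEquiv`); and `res(Γ_K)` has finite index
`[K : ℚ]` (`exists_mem_range_absGaloisRestrict_iff`, `ArtinRestriction`, with Mathlib's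
`IntermediateField.finrank_eq_fixingSubgroup_index`), so a positive power of an inertia element
`τ'` with `χ_ℓ(τ') = 1 + ℓ` is a restriction `res τ`, `τ ∈ I_𝔓`, and
`χ_ℓ^K(τ) = χ_ℓ^ℚ(res τ) = (1 + ℓ)ʲ ≠ 1`.  Also proved here:
`cyclotomicCharacter_eq_cyclotomicCharacter_rat_absGaloisRestrict` (`χ_ℓ^K = χ_ℓ^ℚ ∘ res` for any
field of characteristic `0`), `exists_pow_mem_range_absGaloisRestrict`,
`exists_heightOneSpectrum_rat_under`.

Used (with `det ρ_{E,ℓ} = χ_ℓ`) to produce, at a place `v ∣ ℓ`, an inertia element acting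
non-trivially on the Tate module of an elliptic curve — the last local input of the ordinary
case of Serre's non-abelianness theorem (1968, IV.2.2).

## References

* [SerreAbelianLadic1968] J.-P. Serre, *Abelian ℓ-adic representations and elliptic curves*
  (1968), Ch. I §1.2.
* [NeukirchANT1999] J. Neukirch, *Algebraic Number Theory* (1999), Ch. I §9 (9.4), Ch. II (7.13),
  Ch. IV §1.
-/

noncomputable section

open scoped NumberField Pointwise
open Field IsDedekindDomain NumberField

universe u

namespace Literature.NumberTheory.GaloisRepresentations

/-! ## The cyclotomic character and restriction to `Γ_ℚ` -/

section Restrict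

variable (K : Type u) [Field K] [CharZero K] (ℓ : ℕ) [hℓ : Fact ℓ.Prime]

/-- **`χ_ℓ^K = χ_ℓ^ℚ ∘ res`**: the `ℓ`-adic cyclotomic character of a field `K` of characteristic
`0` is the cyclotomic character of `ℚ` composed with the restriction `Γ_K → Γ_ℚ`
(`absGaloisRestrict ℚ K`, along the chosen embedding `\bar ℚ → \bar K`): both are read off the
action on the `ℓ`-power roots of unity, which correspond under the embedding
(`GaloisRep.cyclotomicCharacter_spec`, `absGaloisRestrict_apply_smul`).
[Serre 1968, I.1.2] [cite: SerreAbelianLadic1968, Ch. I §1.2] -/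
theorem cyclotomicCharacter_eq_cyclotomicCharacter_rat_absGaloisRestrict
    (τ : absoluteGaloisGroup K) :
    GaloisRep.cyclotomicCharacter K ℓ τ =
      GaloisRep.cyclotomicCharacter ℚ ℓ (absGaloisRestrict ℚ K τ) := by
  haveI : NeZero (ℓ : K) := ⟨Nat.cast_ne_zero.mpr hℓ.out.ne_zero⟩
  haveI : NeZero (ℓ : ℚ) := ⟨Nat.cast_ne_zero.mpr hℓ.out.ne_zero⟩
  apply Units.ext
  refine PadicInt.ext_of_toZModPow.mp fun n ↦ ?_
  haveI : NeZero ((ℓ ^ n : ℕ) : AlgebraicClosure ℚ) := ⟨by exact_mod_cast pow_ne_zero n hℓ.out.ne_zero⟩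
  obtain ⟨ζ, hζ⟩ := HasEnoughRootsOfUnity.exists_primitiveRoot (AlgebraicClosure ℚ) (ℓ ^ n)
  set ι := absClosureEmbedding ℚ K with hι
  have hζ' : IsPrimitiveRoot (ι ζ) (ℓ ^ n) := hζ.map_of_injective ι.toRingHom.injective
  have h1 := GaloisRep.cyclotomicCharacter_spec K ℓ (k := n) τ (ι ζ)
    (by rw [← map_pow, hζ.pow_eq_one, map_one])
  have h2 := congrArg ι (GaloisRep.cyclotomicCharacter_spec ℚ ℓ (k := n) (absGaloisRestrict ℚ K τ)
    ζ hζ.pow_eq_one)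
  rw [absGaloisRestrict_apply_smul, map_pow, h1] at h2
  exact ZMod.val_injective _ (hζ'.pow_inj (ZMod.val_lt _) (ZMod.val_lt _) h2)

end Restrict

/-! ## Powers into a subgroup of finite index; the index of `res(Γ_M)` -/

section Index

variable (K : Type u) (M : Type*) [Field K] [Field M] [Algebra K M] [CharZero K]
  [FiniteDimensional K M]

/-- **Some power of every `g ∈ Γ_K` lies in `res(Γ_M)`** for a finite extension `M/K` in
characteristic `0`: the image of `Γ_M → Γ_K` is the fixing subgroup of a copy of `M` in `K̄`
(`exists_mem_range_absGaloisRestrict_iff`), of index `[M : K]`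
(Mathlib `IntermediateField.finrank_eq_fixingSubgroup_index`), and a subgroup of finite index
contains a positive power of every element (`Subgroup.exists_pow_mem_of_index_ne_zero`).
[Neukirch, ANT, Ch. IV §1] [folklore] -/
theorem exists_pow_mem_range_absGaloisRestrict (g : absoluteGaloisGroup K) :
    ∃ j : ℕ, 0 < j ∧ g ^ j ∈ (absGaloisRestrict K M).range := by
  obtain ⟨e, he⟩ := exists_mem_range_absGaloisRestrict_iff K M
  have hK' : (absGaloisRestrict K M).range =
      (e.fieldRange.fixingSubgroup : Subgroup (absoluteGaloisGroup K)) := by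
    ext g
    refine (he g).trans (Iff.trans ?_ (mem_fixingSubgroup_iff_forall_smul e.fieldRange g).symm)
    constructor
    · rintro h ⟨x, ⟨k, rfl⟩⟩
      exact h k
    · intro h k
      exact h ⟨e k, ⟨k, rfl⟩⟩
  haveI : FiniteDimensional K e.fieldRange :=
    LinearEquiv.finiteDimensional e.equivFieldRange.toLinearEquiv
  have hidx' : (absGaloisRestrict K M).range.index = Module.finrank K M := by
    rw [hK', e.equivFieldRange.toLinearEquiv.finrank_eq]
    exact (IntermediateField.finrank_eq_fixingSubgroup_index e.fieldRange).symm
  have hidx : (absGaloisRestrict K M).range.index ≠ 0 := by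
    rw [hidx']
    exact Module.finrank_pos.ne'
  obtain ⟨j, hj, -, hmem⟩ := Subgroup.exists_pow_mem_of_index_ne_zero hidx g
  exact ⟨j, hj, hmem⟩

end Index

/-! ## The place of `ℚ` below a place above `ℓ` -/

section Below

variable {K : Type u} [Field K] [NumberField K]

/-- The prime of `𝓞 ℚ` below a finite place `v` of `K` containing the rational prime `ℓ` is a
finite place of `ℚ`, and its `primesEquiv`-label is `ℓ`. [folklore] -/
theorem exists_heightOneSpectrum_rat_under {ℓ : ℕ} (hℓ : ℓ.Prime) {v : HeightOneSpectrum (𝓞 K)}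
    (hℓv : (ℓ : 𝓞 K) ∈ v.asIdeal) :
    ∃ u : HeightOneSpectrum (𝓞 ℚ), v.asIdeal.under (𝓞 ℚ) = u.asIdeal ∧
      ((Rat.HeightOneSpectrum.primesEquiv u : Nat.Primes) : ℕ) = ℓ := by
  have hmem : (ℓ : 𝓞 ℚ) ∈ v.asIdeal.under (𝓞 ℚ) := by
    rw [Ideal.under_def, Ideal.mem_comap, map_natCast]
    exact hℓv
  have hne : v.asIdeal.under (𝓞 ℚ) ≠ ⊥ := by
    intro h
    rw [h, Ideal.mem_bot, Nat.cast_eq_zero] at hmem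
    exact hℓ.ne_zero hmem
  refine ⟨⟨v.asIdeal.under (𝓞 ℚ), inferInstance, hne⟩, rfl, ?_⟩
  set u : HeightOneSpectrum (𝓞 ℚ) := ⟨v.asIdeal.under (𝓞 ℚ), inferInstance, hne⟩ with hu
  have h1 : Rat.HeightOneSpectrum.natGenerator u ∣ ℓ := by
    rw [Rat.HeightOneSpectrum.natGenerator_dvd_iff, Ideal.mem_map_of_equiv]
    exact ⟨ℓ, hmem, map_natCast _ ℓ⟩
  exact (Nat.prime_dvd_prime_iff_eq (Rat.HeightOneSpectrum.prime_natGenerator u) hℓ).mp h1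

end Below

/-! ## Inertia above `ℓ` and the cyclotomic character -/

section Main

variable {K : Type u} [Field K] [NumberField K] (ℓ : ℕ) [hℓ : Fact ℓ.Prime]

/-- `1 + ℓ` is a unit of `ℤ_ℓ` none of whose positive powers is `1`. [folklore] -/
theorem exists_unit_pow_ne_one : ∃ u : ℤ_[ℓ]ˣ, ∀ j : ℕ, 0 < j → u ^ j ≠ 1 := by
  set k : ℤ := 1 + ℓ with hk
  have hk1 : 1 < k := by have := hℓ.out.one_lt; omega
  have hnorm : ‖(k : ℤ_[ℓ])‖ = 1 := by
    apply le_antisymm (PadicInt.norm_le_one _)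
    by_contra hlt
    rw [not_le, PadicInt.norm_int_lt_one_iff_dvd, hk, dvd_add_self_right] at hlt
    exact hℓ.out.one_lt.ne' (by exact_mod_cast Int.eq_one_of_dvd_one (by positivity) hlt)
  have hu : IsUnit (k : ℤ_[ℓ]) := PadicInt.isUnit_iff.mpr hnorm
  refine ⟨hu.unit, fun j hj h ↦ ?_⟩
  have h' := congrArg (fun x : ℤ_[ℓ]ˣ ↦ (x : ℤ_[ℓ])) h
  simp only [Units.val_pow_eq_pow_val, IsUnit.unit_spec, Units.val_one] at h'
  rw [← Int.cast_pow, ← Int.cast_one, Int.cast_inj] at h'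
  exact (one_lt_pow₀ hk1 hj.ne').ne' h'

/-- **The cyclotomic character of a number field is ramified above `ℓ`.**  For a number field
`K`, a prime `ℓ`, a finite place `v ∣ ℓ` of `K` and a prime `𝔓` of `\bar ℤ_K` above `v`, some
`τ` in the inertia group `I_𝔓 ≤ Γ_K` has `χ_ℓ(τ) ≠ 1`, i.e. moves some `ℓ`-power root of unity
of `K̄`.  Proof by restriction to `ℚ`: `ℚ(μ_{ℓ^∞})/ℚ` is totally ramified at `ℓ`, indeed
`χ_ℓ(I_{𝔓 ∩ \bar ℤ}) = ℤ_ℓˣ` (the tree's `exists_mem_inertia_cyclotomicCharacter_eq`, Neukirch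
II (7.13)); pick there `τ'` with `χ_ℓ(τ') = 1 + ℓ`; a positive power `τ'ʲ` lies in `res(Γ_K)`
(`exists_pow_mem_range_absGaloisRestrict`), say `τ'ʲ = res τ`; then `τ ∈ I_𝔓`
(`comap_inertia_comap_absIntegersMap`, Neukirch I (9.4)) and `χ_ℓ^K(τ) = χ_ℓ^ℚ(τ'ʲ) = (1 + ℓ)ʲ ≠ 1`
(`cyclotomicCharacter_eq_cyclotomicCharacter_rat_absGaloisRestrict`).
[Serre 1968, I.1.2; Neukirch, ANT, II (7.13), I (9.4)] [cite: SerreAbelianLadic1968, Ch. I §1.2] -/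
theorem exists_mem_inertia_cyclotomicCharacter_ne_one {v : HeightOneSpectrum (𝓞 K)}
    (hℓv : (ℓ : 𝓞 K) ∈ v.asIdeal) {𝔓 : Ideal (absIntegers (𝓞 K) K)} (h𝔓 : 𝔓 ∈ v.primesAbove) :
    ∃ τ ∈ 𝔓.inertia (absoluteGaloisGroup K), GaloisRep.cyclotomicCharacter K ℓ τ ≠ 1 := by
  obtain ⟨u, hu, hvu⟩ := exists_heightOneSpectrum_rat_under hℓ.out hℓv
  -- the prime of `\bar ℤ` below `𝔓`
  have h𝔓' : 𝔓.comap (absIntegersMap ℚ K) ∈ u.primesAbove :=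
    comap_absIntegersMap_mem_primesAbove hu h𝔓
  obtain ⟨w, hw⟩ := exists_unit_pow_ne_one ℓ
  obtain ⟨τ', hτ'I, hτ'χ⟩ :=
    Literature.NumberTheory.EllipticCurves.exists_mem_inertia_cyclotomicCharacter_eq ℓ hvu h𝔓' w
  obtain ⟨j, hj, τ, hτ⟩ := exists_pow_mem_range_absGaloisRestrict ℚ K τ'
  have hτ' : absGaloisRestrict ℚ K τ = τ' ^ j := hτ
  refine ⟨τ, ?_, ?_⟩
  · rw [← comap_inertia_comap_absIntegersMap ℚ K 𝔓, Subgroup.mem_comap]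
    change absGaloisRestrict ℚ K τ ∈ _
    rw [hτ']
    exact Subgroup.pow_mem _ hτ'I j
  · rw [cyclotomicCharacter_eq_cyclotomicCharacter_rat_absGaloisRestrict K ℓ τ, hτ', map_pow, hτ'χ]
    exact hw j hj

end Main

end Literature.NumberTheory.GaloisRepresentations

end
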